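import Summits.Ventures.CertifiedArithmetic.LowPrec.DoubleRoundingProductSameQuantumStripTable
import Summits.Ventures.CertifiedArithmetic.LowPrec.DoubleRoundingProductSameQuantumCoarse
import Summits.Ventures.CertifiedArithmetic.LowPrec.DoubleRoundingProductSameQuantumLaw

/-!
# Double rounding of products at equal quanta through ANY more precise register: `P ≤ 3` innocuous

HONEST FRAMING (venture CertifiedArithmetic / cell `pub-lowprec`): certified error envelopes and
provably optimal rounding/accumulation schemes for low-precision formats under stated cost models;
every table by two implementations; no hardware or vendor claims.

`DoubleRoundingProductSameQuantumLaw.lean` decided `DRMul φ ψ` (`fl_φ (fl_ψ (a·b)) = fl_φ (a·b)`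
for all data `a, b` of `φ`) at equal quanta (`L_ψ = L_φ`, `d = 0`) for registers AT LEAST TWICE
as precise (`m_ψ ≥ 2m+1`) and under the range hypothesis `2^(2m+1) ≤ M_φ`.  This file removes
both restrictions on the positive side — the strip `m + 1 ≤ m_ψ ≤ 2m` was known only on three
kernel-enumerated cells (`sameQ_strip_cells`):

  for EVERY pair of records with `F_φ ⊆ F_ψ` (`embedsTest`), `L_ψ = L_φ`, `1 ≤ m = m_φ ≤ 2` and
  ANY `m_ψ ≥ m + 1`:   `DRMul φ ψ`   (`drMul_sameQ_strip_of_manBits_le_two`);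
  with `2^(2m+1) ≤ M_φ`, `2^(bias+m-1) ≤ M_φ` for N-mul-0's witnesses:  `DRMul φ ψ ↔ m ≤ 2`
  for every `m_ψ ≥ m + 1` (`drMul_sameQ_strip_iff`) — the complete decision at `d = 0`.

Mechanism — ONE GRID INSIDE ANOTHER, binade by binade.  A product of `φ`-data is `K·2^E·q`,
`K = oa·ob = c·2^t + r` (`2^m ≤ c < 2^(m+1)`, `2^G ≤ K < 2^(G+1)`, `t = G - m`); it lies in the
binade where `φ` has spacing `2^(k+1) q`, `k + 1 = E + t`.  It is saturated, zero, a value of `ψ`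
(`E ≥ 0`, `G ≤ m_ψ`), in the low zone `G + E ≤ m` (`DoubleRoundingProductSameQuantumLow.lean`), or
in a cell `[c, c+1]·2^(k+1) q` below `maxRat φ` (so `(c+1)·2^(k+1) ≤ M_φ ≤ M_ψ` by the gap above a
normal significand) on which the register (`m_ψ = m + δ`) holds every multiple of `2^e q`:
`e = 0` when `k < δ` (near zone, `g = t-2-k`), `e = k+1-δ` when `δ ≤ k` (scale-free zone,
`g = t-1-δ`, `2^e q` exactly the register spacing); a slip is then a hit of the coarse window
(`DoubleRoundingProductSameQuantumCoarse.lean`) hence of `mulStripHit (m+1) (min δ (m+1))`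
(`DoubleRoundingProductSameQuantumStripTable.lean`), which has NO hit for `P ≤ 3`, `δ ≥ 1`.
No range hypothesis is needed on the positive side.  (For `P ≥ 4` the strip table has hits at
every `δ`, consistent with N-mul-0, whose own witness lives at `d = 0` for every `m_ψ ≥ m+1`.)
Two implementations: A = `code/enum/mul_sameq_strip_law.py` (the table literally, `P ≤ 8`; window
hits = brute-force slips of the exact-rational odd-parts model, pointwise, at every register gap
`δ ≤ P+2`, `P ≤ 7`; brute-force `DRMul` on 387 same-quantum pseudo-record cells `P_φ ≤ 7`,
`m+1 ≤ m_ψ ≤ 2m+3`, six range shapes (one-binade and subnormal-only sources included), agreeing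
with the theorem / the decision on every cell inside their hypotheses, 0 violations) →
`certs/enum/DOUBLE-ROUNDING-MUL-SAMEQ-STRIP.json` (C43); B = this file (structural, every record).
PLACEMENT — KNOWN: innocuous double rounding of products for `p₂ ≥ 2p₁` with unbounded exponents
([Figueroa1995] §3, [BoldoMelquiond2008] Thm 3, [Rump2016IEEE], [MartinDorelMelquiondMuller2013]
Thm 4.1); the midpoint characterisation of slips (ibid. Property 2.1).  We found no statement in
print deciding the equal-`emin` register of ANY larger precision by the source precision alone
(`p₁ ≤ 3` innocuous for all `p₂ > p₁`); searches logged in `pub-lowprec-enum/FRESHNESS-ENUM.md`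
(gen23–gen27) and `DOUBLE-ROUNDING-MUL.md` §10–14.  NEW (modestly): the record-generic positive
side on the whole strip and the complete decision at `d = 0`.  No hardware or vendor claims.
-/

namespace Summit.Ventures.CertifiedArithmetic

open Literature.ComputerArithmetic.FloatingPoint
open Literature.ComputerArithmetic.FloatingPoint.Format
open Literature.ComputerArithmetic.FloatingPoint.MiniFloat

/-! ## §1 The positive side on the whole strip, the complete decision at `d = 0` -/

/-- THE GAP ABOVE A NORMAL SIGNIFICAND, in range form: if `c·2^(k+1) < M_φ` for a normal
significand `2^m ≤ c < 2^(m+1)`, then `(c+1)·2^(k+1) ≤ M_φ` (the top value of `φ` is a value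
above `c·2^(k+1) q`, hence at least the next one). [folklore] -/
theorem succ_mul_pow_le_maxScaled {φ : Format} {c k : ℕ} (hclo : 2 ^ φ.manBits ≤ c)
    (hchi : c < 2 ^ (φ.manBits + 1)) (hlt : c * 2 ^ (k + 1) < φ.maxScaled) :
    (c + 1) * 2 ^ (k + 1) ≤ φ.maxScaled := by
  obtain ⟨v0, hv0⟩ := exists_toRat_eq_natMul (representable_mul_pow hchi hlt.le)
  rcases gap_gmid hclo hv0 (MiniFloat.top φ) with h | h
  · rw [toRat_top] at h
    have h' : (φ.maxScaled : ℚ) * φ.quantum ≤ ((c * 2 ^ (k + 1) : ℕ) : ℚ) * φ.quantum := h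
    have h'' : (φ.maxScaled : ℚ) ≤ ((c * 2 ^ (k + 1) : ℕ) : ℚ) :=
      le_of_mul_le_mul_right h' φ.quantum_pos
    exact absurd (by exact_mod_cast h'') (not_le.mpr hlt)
  · rw [toRat_top] at h
    have h' : (((c + 1) * 2 ^ (k + 1) : ℕ) : ℚ) * φ.quantum ≤ (φ.maxScaled : ℚ) * φ.quantum := h
    exact_mod_cast le_of_mul_le_mul_right h' φ.quantum_pos

/-- NO STRIP HIT, NO SLIP — for EVERY pair of format records with `F_φ ⊆ F_ψ` (`embedsTest`),
`L_ψ = L_φ`, `m = m_φ ≥ 1` and `m_ψ ≥ m + 1` (`δ = m_ψ - m ≥ 1`, ANY more precise register):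
`mulStripHit (m+1) (min δ (m+1)) = false ⟹ DRMul φ ψ`.  A product `K·2^E·q` (`K = oa·ob`,
`2^G ≤ K < 2^(G+1)`) is saturated, zero, a value of `ψ` (`E ≥ 0`, `G ≤ m_ψ`), in the low zone
(`G + E ≤ m`: `sameQ_roundNE_roundNE_low`, the cell index below `maxRat φ`), or in the cell
`[c, c+1]·2^(k+1) q` (`k + 1 = E + G - m`, `(c+1)·2^(k+1) ≤ M_φ` by `succ_mul_pow_le_maxScaled`)
where `sameQ_coarse_window_of_roundNE_roundNE_ne` (`e = 0` if `k < δ`, `e = k+1-δ` if `δ ≤ k`)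
turns a slip into a hit of the strip table. [this packet] -/
theorem drMul_sameQ_of_mulStripHit_eq_false {φ ψ : Format} (hE : embedsTest φ ψ = true)
    (hq : ψ.qexp = φ.qexp) (h1 : 1 ≤ φ.manBits) (hP : φ.manBits + 1 ≤ ψ.manBits)
    (hhit : mulStripHit (φ.manBits + 1) (min (ψ.manBits - φ.manBits) (φ.manBits + 1)) = false) :
    DRMul φ ψ := by
  have htop := exists_toRat_eq_maxRat_of_test hE
  simp only [embedsTest, Bool.and_eq_true, decide_eq_true_eq] at hE
  obtain ⟨⟨-, hq'⟩, hMM⟩ := hE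
  have hmax := (maxRat_le_maxRat_iff hq').2 hMM
  rw [show (φ.qexp - ψ.qexp).toNat = 0 by omega, pow_zero, mul_one] at hMM
  have hQ : ψ.quantum = φ.quantum := by
    show (2 : ℚ) ^ ψ.qexp = (2 : ℚ) ^ φ.qexp
    rw [hq]
  obtain ⟨δ, hδ⟩ : ∃ δ, ψ.manBits = φ.manBits + δ := ⟨ψ.manBits - φ.manBits, by omega⟩
  have hmψ : 2 ^ (φ.manBits + 1) < 2 ^ (ψ.manBits + 1) :=
    Nat.pow_lt_pow_right (by norm_num) (by omega)
  intro a b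
  rcases le_or_gt φ.maxRat |a.toRat * b.toRat| with hsat | hlt
  · exact toRat_roundNE_roundNE_of_maxRat_le_abs htop hsat
  have hltM : |a.toRat * b.toRat| < (φ.maxScaled : ℚ) * φ.quantum := hlt
  have habs := abs_toRat_mul_toRat a b
  by_cases h0 : a.scaledMag * b.scaledMag = 0
  · have hx0 : a.toRat * b.toRat = 0 := abs_eq_zero.mp (by rw [habs, h0]; simp)
    rw [hx0]; exact toRat_roundNE_roundNE_of_exists ⟨zero ψ, toRat_zero⟩
  obtain ⟨ha0, hb0⟩ := mul_ne_zero_iff.mp h0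
  obtain ⟨oa, ja, hoa, hoa', hsa⟩ := exists_odd_mul_two_pow a ha0
  obtain ⟨ob, jb, hob, hob', hsb⟩ := exists_odd_mul_two_pow b hb0
  have hK2 : oa * ob < 2 ^ (2 * φ.manBits + 2) := by
    calc oa * ob < 2 ^ (φ.manBits + 1) * 2 ^ (φ.manBits + 1) :=
          Nat.mul_lt_mul_of_lt_of_le hoa' hob'.le (by positivity)
      _ = 2 ^ (2 * φ.manBits + 2) := by rw [← pow_add]; congr 1; omega
  have hK0 : oa * ob ≠ 0 := by
    intro h; rcases mul_eq_zero.mp h with h' | h' <;> omega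
  -- `|a·b| = K · 2^E · q`, `K = oa·ob`, `E = ja + jb + L_φ`, `2^G ≤ K < 2^(G+1)`
  obtain ⟨E, hE_def⟩ : ∃ E : ℤ, ((ja + jb : ℕ) : ℤ) + 2 * φ.qexp - ψ.qexp = E := ⟨_, rfl⟩
  have h2E : (2 : ℚ) ^ E * 2 ^ ψ.qexp = (2 : ℚ) ^ (ja + jb) * 2 ^ (φ.qexp + φ.qexp) := by
    rw [← zpow_natCast, ← zpow_add₀ two_ne_zero, ← zpow_add₀ two_ne_zero]
    congr 1; push_cast; omega
  have habs' : |a.toRat * b.toRat| = ((oa * ob : ℕ) : ℚ) * (2 : ℚ) ^ E * ψ.quantum := by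
    rw [habs, hsa, hsb]; unfold Format.quantum
    rw [mul_assoc (((oa * ob : ℕ)) : ℚ), h2E]; push_cast; ring
  obtain ⟨G, hG'⟩ : ∃ G, Nat.log 2 (oa * ob) = G := ⟨_, rfl⟩
  have hGle : 2 ^ G ≤ oa * ob := hG' ▸ Nat.pow_log_le_self 2 hK0
  have hGlt : oa * ob < 2 ^ (G + 1) := hG' ▸ Nat.lt_pow_succ_log_self (by norm_num) _
  have hG2 : G ≤ 2 * φ.manBits + 1 := by
    by_contra h
    have := Nat.pow_le_pow_right (n := 2) (by norm_num) (show 2 * φ.manBits + 2 ≤ G by omega)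
    omega
  -- (i) a value of `ψ`
  by_cases hex : 0 ≤ E ∧ G ≤ ψ.manBits
  · obtain ⟨hE0, hGψ⟩ := hex
    have hKψ : oa * ob < 2 ^ (ψ.manBits + 1) :=
      lt_of_lt_of_le hGlt (Nat.pow_le_pow_right (by norm_num) (by omega))
    have hxE : |a.toRat * b.toRat| = ((oa * ob * 2 ^ E.toNat : ℕ) : ℚ) * ψ.quantum := by
      rw [habs']; push_cast; rw [← zpow_natCast, Int.toNat_of_nonneg hE0]
    refine toRat_roundNE_roundNE_of_exists
      (exists_toRat_eq_of_abs_eq_natMul (representable_mul_pow hKψ ?_) hxE)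
    have h' : ((oa * ob * 2 ^ E.toNat : ℕ) : ℚ) * ψ.quantum < (ψ.maxScaled : ℚ) * ψ.quantum := by
      rw [← hxE]; exact lt_of_lt_of_le hlt hmax
    exact_mod_cast (lt_of_mul_lt_mul_right h' ψ.quantum_pos.le).le
  have hnot1 : 0 ≤ E → ψ.manBits + 1 ≤ G := fun h => by by_contra h'; exact hex ⟨h, by omega⟩
  by_contra hne
  have hne' : (roundNE φ (roundNE ψ |a.toRat * b.toRat|).toRat).toRat
      ≠ (roundNE φ |a.toRat * b.toRat|).toRat :=
    fun h => hne (toRat_roundNE_roundNE_of_abs h)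
  by_cases hlz : (G : ℤ) + E ≤ φ.manBits
  · -- (ii) the low zone (`E < 0`)
    have hE0 : E < 0 := by
      by_contra h
      have := hnot1 (by omega)
      omega
    obtain ⟨u, hu'⟩ : ∃ u : ℕ, (-E).toNat = u := ⟨_, rfl⟩
    obtain ⟨hu, hEu⟩ : 1 ≤ u ∧ E = -(u : ℤ) := ⟨by omega, by omega⟩
    have hxu : |a.toRat * b.toRat| = ((oa * ob : ℕ) : ℚ) * φ.quantum / 2 ^ u := by
      rw [habs', hEu, zpow_neg, zpow_natCast, hQ]; ring
    obtain ⟨c, hc'⟩ : ∃ c, oa * ob / 2 ^ u = c := ⟨_, rfl⟩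
    obtain ⟨r, hr'⟩ : ∃ r, oa * ob % 2 ^ u = r := ⟨_, rfl⟩
    obtain ⟨hKcr, hrK⟩ := (Nat.div_mod_unique (a := oa * ob) (b := 2 ^ u) (c := r) (d := c)
      (by positivity)).mp ⟨hc', hr'⟩
    have hKcr' : oa * ob = c * 2 ^ u + r := by rw [← hKcr]; ring
    have hcu : c < 2 ^ (φ.manBits + 1) := by
      rw [← hc', Nat.div_lt_iff_lt_mul (by positivity), ← pow_add]
      exact lt_of_lt_of_le hGlt (Nat.pow_le_pow_right (by norm_num) (by omega))
    have hcM : c < φ.maxScaled := by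
      have h1' : ((c : ℕ) : ℚ) * φ.quantum ≤ ((oa * ob : ℕ) : ℚ) * φ.quantum / 2 ^ u := by
        rw [hKcr', le_div_iff₀ (by positivity)]; push_cast
        have : (0 : ℚ) ≤ (r : ℚ) * φ.quantum := mul_nonneg (Nat.cast_nonneg _) φ.quantum_pos.le
        nlinarith [φ.quantum_pos, pow_pos (two_pos : (0 : ℚ) < 2) u]
      have hlt2 := hltM
      rw [hxu] at hlt2
      have h2' := lt_of_le_of_lt h1' hlt2
      exact_mod_cast lt_of_mul_lt_mul_right h2' φ.quantum_pos.le
    rw [hxu, hKcr'] at hne'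
    exact hne' (sameQ_roundNE_roundNE_low hq h1 (by omega) hu hrK (by omega) (by omega)
      (by omega) (by omega))
  -- (iii) a cell `[c, c+1]·2^(k+1) q`, `K = c·2^t + r`, `t = G - m ≥ 2`, `k + 1 = E + t ≥ 1`
  have hGm : φ.manBits + 2 ≤ G := by
    rcases le_or_gt 0 E with h | h
    · have := hnot1 h; omega
    · omega
  obtain ⟨t, ht'⟩ : ∃ t, G - φ.manBits = t := ⟨_, rfl⟩
  have hGt : G = φ.manBits + t := by omega
  have htP : t ≤ φ.manBits + 1 := by omega
  obtain ⟨k, hk'⟩ : ∃ k : ℕ, (E + t - 1).toNat = k := ⟨_, rfl⟩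
  have hk : (k : ℤ) + 1 = E + t := by omega
  obtain ⟨c, hc'⟩ : ∃ c, oa * ob / 2 ^ t = c := ⟨_, rfl⟩
  obtain ⟨r, hr'⟩ : ∃ r, oa * ob % 2 ^ t = r := ⟨_, rfl⟩
  obtain ⟨hKcr, hrK⟩ := (Nat.div_mod_unique (a := oa * ob) (b := 2 ^ t) (c := r) (d := c)
    (by positivity)).mp ⟨hc', hr'⟩
  have hKcr' : oa * ob = c * 2 ^ t + r := by rw [← hKcr]; ring
  have hclo : 2 ^ φ.manBits ≤ c := by
    rw [← hc', Nat.le_div_iff_mul_le (by positivity), ← pow_add, ← hGt]; exact hGle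
  have hchi : c < 2 ^ (φ.manBits + 1) := by
    rw [← hc', Nat.div_lt_iff_lt_mul (by positivity), ← pow_add,
      show φ.manBits + 1 + t = G + 1 by omega]
    exact hGlt
  have h2E' : (2 : ℚ) ^ E = 2 ^ (k + 1) / 2 ^ t := by
    rw [eq_div_iff (by positivity), ← zpow_natCast, ← zpow_natCast, ← zpow_add₀ two_ne_zero]
    congr 1; push_cast; omega
  have hxc : |a.toRat * b.toRat|
      = ((c * 2 ^ t + r : ℕ) : ℚ) * φ.quantum * 2 ^ (k + 1) / 2 ^ t := by
    rw [habs', hKcr', hQ, h2E']; ring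
  rw [hxc] at hne' hltM
  have hcM : (c + 1) * 2 ^ (k + 1) ≤ φ.maxScaled := by
    refine succ_mul_pow_le_maxScaled hclo hchi ?_
    have h1' : ((c * 2 ^ (k + 1) : ℕ) : ℚ) * φ.quantum
        ≤ ((c * 2 ^ t + r : ℕ) : ℚ) * φ.quantum * 2 ^ (k + 1) / 2 ^ t := by
      rw [le_div_iff₀ (by positivity)]; push_cast
      have : (0 : ℚ) ≤ (r : ℚ) * φ.quantum * 2 ^ (k + 1) :=
        mul_nonneg (mul_nonneg (Nat.cast_nonneg _) φ.quantum_pos.le) (by positivity)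
      nlinarith [φ.quantum_pos, pow_pos (two_pos : (0 : ℚ) < 2) t,
        pow_pos (two_pos : (0 : ℚ) < 2) (k + 1)]
    have h2' := lt_of_le_of_lt h1' hltM
    exact_mod_cast lt_of_mul_lt_mul_right h2' φ.quantum_pos.le
  have hψM : (c + 1) * 2 ^ (k + 1) ≤ ψ.maxScaled := le_trans hcM hMM
  have hc2 : (c + 1) * 2 ^ (k + 1) ≤ 2 ^ (φ.manBits + 1 + (k + 1)) := by
    rw [pow_add 2 (φ.manBits + 1) (k + 1)]; exact Nat.mul_le_mul_right _ hchi
  have hclo' : 2 ^ (φ.manBits + 1 - 1) ≤ c := by rw [Nat.add_sub_cancel]; exact hclo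
  rcases Nat.lt_or_ge k δ with hkδ | hkδ
  · -- near zone: the register holds every multiple of `q` on the cell (`e = 0`, `E < 0`)
    have hE0 : E < 0 := by
      by_contra h
      have := hnot1 (by omega)
      omega
    have hkt : k + 2 ≤ t := by omega
    have hwin := sameQ_coarse_window_of_roundNE_roundNE_ne hq h1 (by omega) (t := t) (k := k)
      (e := 0) (g := t - 2 - k) (by omega) (by omega) (by omega) hrK hclo hchi hcM
      (le_trans hc2 (Nat.pow_le_pow_right (by norm_num) (by omega))) hψM
      (fun h => absurd h (by omega)) hne'
    simp only [zero_add] at hwin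
    have hAt := mulStripWinAt_of_window (P := φ.manBits + 1) (T := 1 ≤ k) hKcr' hrK hclo'
      hchi hwin
    have := mulStripHit_of_winAt_near (P := φ.manBits + 1)
      (δ := min (ψ.manBits - φ.manBits) (φ.manBits + 1))
      (show k < min (min (ψ.manBits - φ.manBits) (φ.manBits + 1)) (φ.manBits + 1 - 1) by omega)
      hkt htP hoa hoa' hob hob' hAt
    rw [hhit] at this
    exact Bool.false_ne_true this
  · -- scale-free zone: the register holds every multiple of `2^(k+1-δ) q`, its spacing there
    have htδ : δ + 1 ≤ t := by
      rcases le_or_gt 0 E with h | h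
      · have := hnot1 h; omega
      · omega
    have hmin : min (ψ.manBits - φ.manBits) (φ.manBits + 1) = δ := by omega
    rw [hmin] at hhit
    have hwin := sameQ_coarse_window_of_roundNE_roundNE_ne hq h1 (by omega) (t := t) (k := k)
      (e := k + 1 - δ) (g := t - 1 - δ) (by omega) (by omega) (by omega) hrK hclo hchi hcM
      (by rw [show ψ.manBits + 1 + (k + 1 - δ) = φ.manBits + 1 + (k + 1) by omega]; exact hc2)
      hψM
      (fun _ => by
        rw [show ψ.manBits + (k + 1 - δ) = φ.manBits + (k + 1) by omega, pow_add]
        exact Nat.mul_le_mul_right _ hclo)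
      hne'
    simp only [show (k + 1 - δ + 1 ≤ k) ↔ (2 ≤ δ) from ⟨fun h => by omega, fun h => by omega⟩]
      at hwin
    have hAt := mulStripWinAt_of_window (P := φ.manBits + 1) (T := 2 ≤ δ) hKcr' hrK hclo'
      hchi hwin
    have := mulStripHit_of_winAt_far (P := φ.manBits + 1) (δ := δ) (by omega) htP hoa hoa'
      hob hob' hAt
    rw [hhit] at this
    exact Bool.false_ne_true this

/-- THE POSITIVE SIDE ON THE WHOLE STRIP, every record: `F_φ ⊆ F_ψ`, `L_ψ = L_φ`,
`1 ≤ m_φ ≤ 2` (`P_φ ≤ 3`) and ANY `m_ψ ≥ m_φ + 1` `⟹ DRMul φ ψ` — no range hypothesis (the strip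
table has no hit for `P ≤ 3`, `1 ≤ δ ≤ P`). [this packet] -/
theorem drMul_sameQ_strip_of_manBits_le_two {φ ψ : Format} (hE : embedsTest φ ψ = true)
    (hq : ψ.qexp = φ.qexp) (h1 : 1 ≤ φ.manBits) (hP : φ.manBits + 1 ≤ ψ.manBits)
    (h2 : φ.manBits ≤ 2) : DRMul φ ψ :=
  drMul_sameQ_of_mulStripHit_eq_false hE hq h1 hP
    (mulStripHit_eq_false_of_le_three (by omega) (by omega) (Nat.min_le_right _ _))

/-- THE COMPLETE DECISION AT EQUAL QUANTA — for EVERY pair of records with `F_φ ⊆ F_ψ`,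
`L_ψ = L_φ`, `m = m_φ ≥ 1`, ANY `m_ψ ≥ m + 1`, and the two range hypotheses of N-mul-0's
witnesses `2^(2m+1) ≤ M_φ`, `2^(bias+m-1) ≤ M_φ` (`1 ≤ maxRat φ`):   `DRMul φ ψ ↔ m ≤ 2`.
(`drMul_sameQ_iff` is the case `m_ψ ≥ 2m+1`.) [this packet] -/
theorem drMul_sameQ_strip_iff {φ ψ : Format} (hE : embedsTest φ ψ = true)
    (hq : ψ.qexp = φ.qexp) (h1 : 1 ≤ φ.manBits) (hP : φ.manBits + 1 ≤ ψ.manBits)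
    (hR : 2 ^ (2 * φ.manBits + 1) ≤ φ.maxScaled)
    (hone : 2 ^ (φ.bias + φ.manBits - 1) ≤ φ.maxScaled) : DRMul φ ψ ↔ φ.manBits ≤ 2 := by
  refine ⟨fun hD => ?_, drMul_sameQ_strip_of_manBits_le_two hE hq h1 hP⟩
  by_contra h2
  have hE' := hE
  simp only [embedsTest, Bool.and_eq_true, decide_eq_true_eq] at hE'
  obtain ⟨⟨-, hq'⟩, hMM⟩ := hE'
  rw [show (φ.qexp - ψ.qexp).toNat = 0 by omega, pow_zero, mul_one] at hMM
  exact not_drMul_sameQ_of_three_le hq (by omega) hP hMM hR hone hD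

/-- THE HYPOTHESIS OF THE POSITIVE SIDE AS A BOOLEAN TEST on records (embedding, equal quanta,
`m_φ ≥ 1`, `m_ψ ≥ m_φ + 1`). [this packet] -/
def mulSameQStripHyp (φ ψ : Format) : Bool :=
  embedsTest φ ψ && decide (ψ.qexp = φ.qexp) && decide (1 ≤ φ.manBits) &&
    decide (φ.manBits + 1 ≤ ψ.manBits)

/-- THE POSITIVE SIDE UNDER THE BOOLEAN HYPOTHESIS: `mulSameQStripHyp φ ψ ⟹ m_φ ≤ 2 ⟹ DRMul φ ψ`.
[this packet] -/
theorem drMul_of_mulSameQStripHyp {φ ψ : Format} (h : mulSameQStripHyp φ ψ = true)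
    (h2 : φ.manBits ≤ 2) : DRMul φ ψ := by
  simp only [mulSameQStripHyp, Bool.and_eq_true, decide_eq_true_eq] at h
  obtain ⟨⟨⟨hE, hq⟩, h1⟩, hP⟩ := h
  exact drMul_sameQ_strip_of_manBits_le_two hE hq h1 hP h2

/-! ## §2 Instances: the strip cells without exhaustion, deep records beyond any enumeration -/

/-- THE STRIP CELLS OF `DoubleRoundingProductSameQuantum.lean` §3 BY THE THEOREM (there: kernel
exhaustion of the `16`- and `64`-value sources through registers of precision `P+1`, `P+2`;
here: four record inequalities each): `Z2 → Z2r3`, `Z3 → Z3r4`, `Z3 → Z3r5` innocuous.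
[this packet] -/
theorem sameQ_strip_cells_by_law : DRMul Z2 Z2r3 ∧ DRMul Z3 Z3r4 ∧ DRMul Z3 Z3r5 :=
  ⟨drMul_of_mulSameQStripHyp (by decide) (by decide),
    drMul_of_mulSameQStripHyp (by decide) (by decide),
    drMul_of_mulSameQStripHyp (by decide) (by decide)⟩

/-- A deep `P = 3` source: `m = 2`, `bias = 30`, `emaxCode = 60` (`L = -31`, `M = 7·2^59`;
its products span `122` binades — no kernel enumeration is attempted). [this packet] -/
def Z3deep : Format := ⟨2, 30, 60, 3, by decide⟩
/-- Its same-quantum register of precision `4 = P + 1`: `m = 3`, `bias = 29`, `L = -31`,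
`M = 15·2^69`. [this packet] -/
def R3deep4 : Format := ⟨3, 29, 70, 7, by decide⟩
/-- Its same-quantum register of precision `5 = P + 2` with the SAME top binade as the source
(`M = 31·2^57 ≥ 7·2^59`): `m = 4`, `bias = 28`, `L = -31`. [this packet] -/
def R3deep5 : Format := ⟨4, 28, 58, 15, by decide⟩
/-- A deep `P = 2` source: `m = 1`, `bias = 40`, `emaxCode = 81` (`L = -40`, `M = 3·2^80`).
[this packet] -/
def Z2deep : Format := ⟨1, 40, 81, 1, by decide⟩
/-- Its same-quantum register of precision `3 = P + 1`: `m = 2`, `bias = 39`, `L = -40`,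
`M = 7·2^79`. [this packet] -/
def R2deep3 : Format := ⟨2, 39, 80, 3, by decide⟩

/-- CELLS NO KERNEL ENUMERATES, by the theorem: the deep `P = 3` source is innocuous through its
same-quantum registers of precision `4` and `5`, the deep `P = 2` source through its register of
precision `3` — four record inequalities each. [this packet] -/
theorem sameQ_strip_deep_cells :
    DRMul Z3deep R3deep4 ∧ DRMul Z3deep R3deep5 ∧ DRMul Z2deep R2deep3 :=
  ⟨drMul_of_mulSameQStripHyp (by decide) (by decide),
    drMul_of_mulSameQStripHyp (by decide) (by decide),
    drMul_of_mulSameQStripHyp (by decide) (by decide)⟩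

/-- THE NAMED `13 × 13` MATRIX: the hypothesis holds on NO named pair (equal quanta occur only at
equal precision) — the same-quantum register is a design point, not a named pair. [this packet] -/
theorem mulSameQStripHyp_named : ∀ X ∈ namedFormats, ∀ Y ∈ namedFormats,
    mulSameQStripHyp X Y = false := by
  decide

end Summit.Ventures.CertifiedArithmetic
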